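import Mathlib
import Literature.MathematicalPhysics.StatisticalMechanics.HardCoreCanonical
import Literature.Probability.LatticeModels.PolymerPressure
import HarnessLib

/-!
# `StaticScoreResponse` (support item stmt-AtomisticToContinuum-12269): the polymer representation
# of the canonical hard-core partition function

For the canonical hard-core gas of independent points of `HardCoreCanonical` (labels `ι`, common law
`ν`, overlap relation `O`), the hard-core probability `Ξ(W) = ℙ(no two points labelled by W overlap)`
(`hcProb`) of a finite set of labels `W` equals the partition function of the **subset polymer gas**
on `W`: polymers are the subsets `B ⊆ W` with at least two elements, two polymers are incompatible
iff they are equal or intersect (`polyInc`), and the activity of `B` is the integrated Ursell weight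
`ζ(B) = ∫ u_B dℙ` (Pulvirenti–Tsagkarogiannis 2012, §3: "the canonical partition function as a
polymer model on vertex sets").

* `hcProb_eq_polymerPartitionFunction` —
  `Ξ(W) = polymerPartitionFunction polyInc ζ {B ⊆ W : 2 ≤ |B|}`.

Proof: strong induction on `W`; the rooted decorated Mayer expansion with the trivial decoration
`g = 1` (`integral_mul_efR_eq_sum`: `Ξ(W) = ∑_{B ∋ i} ζ(B) Ξ(W ∖ B)`, singletons having activity
`1`) matches the deletion recursion of the polymer partition function for the clique of polymers
containing the label `i` (`polymerPartitionFunction_eq_sdiff_add_sum`). No definitions, no named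
facts; everything is folklore given the two cited expansions.
-/

noncomputable section

namespace Summit.AtomisticToContinuum.HydrodynamicLimit.Theorems

open Finset MeasureTheory Literature.Probability.LatticeModels
  Literature.MathematicalPhysics.StatisticalMechanics

section Combinatorics

variable {ι : Type*} [DecidableEq ι]

omit [DecidableEq ι] in
/-- The polymers of the empty label set: none. [folklore] -/
theorem filter_powerset_empty_card :
    ((∅ : Finset ι).powerset.filter fun B => 2 ≤ B.card) = ∅ := by
  ext B
  simp only [Finset.powerset_empty, Finset.mem_filter, Finset.mem_singleton, Finset.notMem_empty,
    iff_false, not_and, not_le]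
  rintro rfl
  simp

/-- Removing the clique of polymers through `i` leaves the polymers of `W.erase i`. [folklore] -/
theorem filter_powerset_sdiff_filter_mem (W : Finset ι) (i : ι) :
    (W.powerset.filter fun B => 2 ≤ B.card) \
        ((W.powerset.filter fun B => 2 ≤ B.card).filter fun B => i ∈ B) =
      (W.erase i).powerset.filter fun B => 2 ≤ B.card := by
  ext B
  simp only [Finset.mem_sdiff, Finset.mem_filter, Finset.mem_powerset, not_and]
  constructor
  · rintro ⟨⟨hBW, hB2⟩, h⟩
    exact ⟨Finset.subset_erase.2 ⟨hBW, h ⟨hBW, hB2⟩⟩, hB2⟩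
  · rintro ⟨hB, hB2⟩
    rw [Finset.subset_erase] at hB
    exact ⟨⟨hB.1, hB2⟩, fun _ => hB.2⟩

/-- The polymers of `W.erase i` compatible with a polymer `γ ∋ i` are the polymers of `W ∖ γ`.
[folklore] -/
theorem filter_not_polyInc_eq (W : Finset ι) {i : ι} {γ : Finset ι} (hiγ : i ∈ γ) :
    (((W.erase i).powerset.filter fun B => 2 ≤ B.card).filter fun B => ¬ polyInc γ B) =
      (W \ γ).powerset.filter fun B => 2 ≤ B.card := by
  ext B
  simp only [Finset.mem_filter, Finset.mem_powerset, polyInc, not_or, Finset.not_nonempty_iff_eq_empty]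
  constructor
  · rintro ⟨⟨hB, hB2⟩, -, hdisj⟩
    refine ⟨fun j hj => Finset.mem_sdiff.2 ⟨Finset.mem_of_mem_erase (hB hj), fun hjγ => ?_⟩, hB2⟩
    have : j ∈ γ ∩ B := Finset.mem_inter.2 ⟨hjγ, hj⟩
    rw [hdisj] at this
    exact Finset.notMem_empty j this
  · rintro ⟨hB, hB2⟩
    have hBW : B ⊆ W := fun j hj => (Finset.mem_sdiff.1 (hB hj)).1
    have hdisj : γ ∩ B = ∅ := by
      refine Finset.eq_empty_of_forall_notMem fun j hj => ?_
      obtain ⟨hjγ, hjB⟩ := Finset.mem_inter.1 hj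
      exact (Finset.mem_sdiff.1 (hB hjB)).2 hjγ
    have hiB : i ∉ B := fun hiB => (Finset.mem_sdiff.1 (hB hiB)).2 hiγ
    refine ⟨⟨Finset.subset_erase.2 ⟨hBW, hiB⟩, hB2⟩, ?_, hdisj⟩
    rintro rfl
    exact hiB hiγ

/-- The rooted index set of the decorated expansion: subsets of `W` through `i` are `{i}` together
with the polymers through `i`. [folklore] -/
theorem filter_powerset_mem_erase_singleton (W : Finset ι) (i : ι) :
    (W.powerset.filter fun B => i ∈ B).erase {i} =
      (W.powerset.filter fun B => 2 ≤ B.card).filter fun B => i ∈ B := by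
  ext B
  simp only [Finset.mem_erase, Finset.mem_filter, Finset.mem_powerset]
  constructor
  · rintro ⟨hne, hBW, hiB⟩
    refine ⟨⟨hBW, ?_⟩, hiB⟩
    obtain ⟨j, hj, hji⟩ : ∃ j ∈ B, j ≠ i := by
      by_contra h
      push Not at h
      apply hne
      ext j
      simp only [Finset.mem_singleton]
      exact ⟨fun hj => h j hj, fun hj => hj ▸ hiB⟩
    exact Finset.one_lt_card.2 ⟨i, hiB, j, hj, hji.symm⟩
  · rintro ⟨⟨hBW, hB2⟩, hiB⟩
    refine ⟨?_, hBW, hiB⟩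
    rintro rfl
    simp at hB2

end Combinatorics

variable {ι : Type*} [Fintype ι] [DecidableEq ι] {X : Type*} [MeasurableSpace X]
  {O : X → X → Prop} (ν : Measure X) [IsProbabilityMeasure ν]

omit [DecidableEq ι] in
/-- The hard-core probability of no labels is `1`. [folklore] -/
theorem hcProb_empty : hcProb O ν (∅ : Finset ι) = 1 := by
  rw [hcProb]
  have : hardCoreSet O (∅ : Finset ι) = (Set.univ : Set (ι → X)) := by
    ext x; simp [hardCoreSet]
  rw [this]
  simp

omit [Fintype ι] [MeasurableSpace X] in
/-- The Ursell weight of a singleton is `1`. [folklore] -/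
theorem uR_singleton (x : ι → X) (i : ι) : uR O x {i} = 1 := by
  simp [uR]

/-- **Polymer representation of the canonical hard-core partition function**
(Pulvirenti–Tsagkarogiannis 2012, §3): the hard-core probability of the labels `W` is the
partition function of the subset polymer gas on `W` — polymers `B ⊆ W` with `|B| ≥ 2`,
incompatibility `polyInc` (equal or intersecting), activities `ζ(B) = ∫ u_B dℙ` (integrated Ursell
weights). [folklore] -/
theorem hcProb_eq_polymerPartitionFunction (hO : MeasurableSet {p : X × X | O p.1 p.2})
    (W : Finset ι) :
    ((hcProb O ν W : ℝ) : ℂ) =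
      polymerPartitionFunction polyInc
        (fun B : Finset ι => ((∫ x, uR O x B ∂Measure.pi (fun _ : ι => ν) : ℝ) : ℂ))
        (W.powerset.filter fun B => 2 ≤ B.card) := by
  induction W using Finset.strongInductionOn with
  | _ W ih =>
    rcases W.eq_empty_or_nonempty with rfl | ⟨i, hi⟩
    · rw [hcProb_empty, filter_powerset_empty_card, polymerPartitionFunction_empty]
      simp
    · -- notation
      set ζ : Finset ι → ℂ := fun B => ((∫ x, uR O x B ∂Measure.pi (fun _ : ι => ν) : ℝ) : ℂ)
        with hζ
      set Λ : Finset (Finset ι) := W.powerset.filter fun B => 2 ≤ B.card with hΛ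
      set D : Finset (Finset ι) := Λ.filter fun B => i ∈ B with hD
      -- probabilistic side: the rooted decorated expansion with `g = 1`
      have hprob : hcProb O ν W = hcProb O ν (W.erase i) +
          ∑ γ ∈ D, (∫ x, uR O x γ ∂Measure.pi (fun _ : ι => ν)) * hcProb O ν (W \ γ) := by
        have h1 := integral_mul_efR_eq_sum ν hO hi (g := fun _ => (1 : ℝ)) measurable_const
          (C := 1) (fun _ => by simp)
        simp only [one_mul] at h1
        rw [integral_efR ν hO] at h1
        rw [h1, ← Finset.add_sum_erase _ _ (Finset.mem_filter.2 ⟨Finset.mem_powerset.2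
          (Finset.singleton_subset_iff.2 hi), Finset.mem_singleton_self i⟩),
          filter_powerset_mem_erase_singleton, Finset.sdiff_singleton_eq_erase]
        congr 1
        · rw [decAct]
          simp [uR_singleton]
        · refine Finset.sum_congr rfl fun γ _ => ?_
          rw [decAct]
          simp
      -- polymer side: deletion of the clique of polymers through `i`
      have hDΛ : D ⊆ Λ := Finset.filter_subset _ _
      have hclique : ∀ γ ∈ D, ∀ γ' ∈ D, γ ≠ γ' → polyInc γ γ' := by
        intro γ hγ γ' hγ' _
        exact Or.inr ⟨i, Finset.mem_inter.2 ⟨(Finset.mem_filter.1 hγ).2, (Finset.mem_filter.1 hγ').2⟩⟩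
      have hpoly := polymerPartitionFunction_eq_sdiff_add_sum (inc := polyInc) ζ hDΛ hclique
      rw [hpoly, hprob]
      rw [hD, hΛ, filter_powerset_sdiff_filter_mem]
      push_cast
      congr 1
      · exact ih (W.erase i) (Finset.erase_ssubset hi)
      · refine Finset.sum_congr rfl fun γ hγ => ?_
        have hγ' := Finset.mem_filter.1 hγ
        have hiγ : i ∈ γ := hγ'.2
        have hγW : γ ⊆ W := Finset.mem_powerset.1 (Finset.mem_filter.1 hγ'.1).1
        rw [filter_not_polyInc_eq W hiγ, ih (W \ γ) (Finset.sdiff_ssubset hγW ⟨i, hiγ⟩)]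

end Summit.AtomisticToContinuum.HydrodynamicLimit.Theorems

end
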